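import Literature.AlgebraicGeometry.Motives.LinesGenerateChowOneLinear
import Literature.RingTheory.MvPolynomial.VariableIdeals
import HarnessLib

/-!
# Split quadratic forms `x_s x_{s+1} + x_{s+2} x_{s+3} + ⋯` and killing variables

Pure algebra behind the normal forms and the cellular decomposition of quadrics
(`Motives/SplitQuadricNormalForm`, `Motives/QuadricStrataIdeals`):

* `splitForm k N = x₀x₁ + x₂x₃ + ⋯ (+ x_N²)` on all `N + 1` variables and the block version
  `splitFormAt k s m` on `x_s, …, x_{s+m-1}` (`splitForm_eq_splitFormAt`), with the recursion
  `splitFormAt s (m+2) = x_s x_{s+1} + splitFormAt (s+2) m`, homogeneity, evaluation, non-vanishing;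
* `sum_eq_sum_pairs` — grouping a sum over `Fin (N + 1)` into the pairs `{2i, 2i+1}`;
* `killSet S` — the substitution `xⱼ ↦ 0 (j ∈ S)`: kernel `(xⱼ : j ∈ S)`
  (`Literature.RingTheory.MvPolynomial.ker_aeval_ite_eq_span`), idempotence, and
  `killSet_splitFormAt` (killing variables outside the block fixes the block form).

Everything is proved; no named facts.

## References

* J.-P. Serre, *A Course in Arithmetic*, IV §1. [folklore]
-/

noncomputable section

open CategoryTheory AlgebraicGeometry Order

universe u

namespace Literature.AlgebraicGeometry.Motives

namespace ProjectiveSpaceCells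

open _root_.MvPolynomial

section SplitForm

variable (k : Type u) [Field k] (N : ℕ)

/-- **The split quadratic form `x₀x₁ + x₂x₃ + ⋯ (+ x_N²)`** in `N + 1` variables: the sum over even
`i` of `xᵢxᵢ₊₁` (or `xᵢ²` for the unpaired last index `i = N`, `N` even). [folklore] -/
def splitForm : MvPolynomial (Fin (N + 1)) k :=
  ∑ i : Fin (N + 1), if (i : ℕ) % 2 = 0 then
    (if h : (i : ℕ) + 1 < N + 1 then MvPolynomial.X i * MvPolynomial.X ⟨(i : ℕ) + 1, h⟩
      else MvPolynomial.X i * MvPolynomial.X i) else 0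

/-- The split form is a quadratic form. [folklore] -/
theorem isHomogeneous_splitForm : (splitForm k N).IsHomogeneous 2 := by
  unfold splitForm
  refine MvPolynomial.IsHomogeneous.sum _ _ _ fun i _ ↦ ?_
  split_ifs
  · exact (MvPolynomial.isHomogeneous_X k _).mul (MvPolynomial.isHomogeneous_X k _)
  · exact (MvPolynomial.isHomogeneous_X k _).mul (MvPolynomial.isHomogeneous_X k _)
  · exact MvPolynomial.isHomogeneous_zero _ _ _

variable {k N}

/-- Evaluation of the split form. [folklore] -/
theorem eval_splitForm (u : Fin (N + 1) → k) :
    MvPolynomial.eval u (splitForm k N) = ∑ i : Fin (N + 1), if (i : ℕ) % 2 = 0 then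
      (if h : (i : ℕ) + 1 < N + 1 then u i * u ⟨(i : ℕ) + 1, h⟩ else u i * u i) else 0 := by
  simp only [splitForm, map_sum]
  refine Finset.sum_congr rfl fun i _ ↦ ?_
  split_ifs <;> simp

/-- **Grouping a sum over `Fin (N + 1)` into consecutive pairs** `{2i, 2i+1}` (and the singleton
`{N}` when `N` is even). [folklore] -/
theorem sum_eq_sum_pairs {M : Type*} [AddCommMonoid M] (e : Fin (N + 1) → M) :
    ∑ j, e j = ∑ i : Fin (N + 1), if (i : ℕ) % 2 = 0 then
      (e i + if h : (i : ℕ) + 1 < N + 1 then e ⟨(i : ℕ) + 1, h⟩ else 0) else 0 := by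
  classical
  -- fibre the left sum along `j ↦ 2 ⌊j/2⌋`
  let g : Fin (N + 1) → Fin (N + 1) := fun j ↦ ⟨2 * ((j : ℕ) / 2), by omega⟩
  rw [← Finset.sum_fiberwise Finset.univ g e]
  refine Finset.sum_congr rfl fun i _ ↦ ?_
  by_cases hi : (i : ℕ) % 2 = 0
  · rw [if_pos hi]
    by_cases h : (i : ℕ) + 1 < N + 1
    · rw [dif_pos h]
      have hfib : Finset.univ.filter (fun j ↦ g j = i) = {i, ⟨(i : ℕ) + 1, h⟩} := by
        ext j
        simp only [Finset.mem_filter, Finset.mem_univ, true_and, Finset.mem_insert,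
          Finset.mem_singleton, g, Fin.ext_iff]
        constructor
        · intro hj; omega
        · intro hj; omega
      rw [hfib, Finset.sum_pair (by simp [Fin.ext_iff])]
    · rw [dif_neg h, add_zero]
      have hfib : Finset.univ.filter (fun j ↦ g j = i) = {i} := by
        ext j
        simp only [Finset.mem_filter, Finset.mem_univ, true_and, Finset.mem_singleton, g,
          Fin.ext_iff]
        constructor
        · intro hj; omega
        · intro hj; omega
      rw [hfib, Finset.sum_singleton]
  · rw [if_neg hi]
    have hfib : Finset.univ.filter (fun j ↦ g j = i) = ∅ := by
      ext j
      simp only [Finset.mem_filter, Finset.mem_univ, true_and, Finset.notMem_empty, iff_false, g,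
        Fin.ext_iff]
      omega
    rw [hfib, Finset.sum_empty]


end SplitForm

/-! ### The split form on a block of variables -/

section SplitFormAt

variable (k : Type u) [Field k] {N : ℕ}

/-- **The split form `x_s x_{s+1} + x_{s+2} x_{s+3} + ⋯` on the block `x_s, …, x_{s+m-1}`**
(`+ x_{s+m-1}²` when `m` is odd). [folklore] -/
def splitFormAt (s m : ℕ) (hsm : s + m ≤ N + 1) : MvPolynomial (Fin (N + 1)) k :=
  ∑ i : Fin (N + 1), if s ≤ (i : ℕ) ∧ (i : ℕ) < s + m ∧ ((i : ℕ) - s) % 2 = 0 then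
    (if h : (i : ℕ) + 1 < s + m then MvPolynomial.X i * MvPolynomial.X ⟨(i : ℕ) + 1, by omega⟩
      else MvPolynomial.X i * MvPolynomial.X i) else 0

variable {k}

/-- The empty block: `splitFormAt s 0 = 0`. [folklore] -/
theorem splitFormAt_zero (s : ℕ) (h : s + 0 ≤ N + 1) : splitFormAt k s 0 h = 0 := by
  unfold splitFormAt
  exact Finset.sum_eq_zero fun i _ ↦ by rw [if_neg]; omega

/-- A block of one variable: `splitFormAt s 1 = x_s²`. [folklore] -/
theorem splitFormAt_one (s : ℕ) (h : s + 1 ≤ N + 1) :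
    splitFormAt k s 1 h = MvPolynomial.X ⟨s, by omega⟩ * MvPolynomial.X ⟨s, by omega⟩ := by
  unfold splitFormAt
  rw [Finset.sum_eq_single ⟨s, by omega⟩]
  · rw [if_pos (by simp), dif_neg (by simp)]
  · intro i _ hi
    rw [if_neg]
    intro hc
    exact hi (Fin.ext (by simp; omega))
  · intro h; exact absurd (Finset.mem_univ _) h

/-- **Peeling the first hyperbolic pair**: `splitFormAt s (m + 2) = x_s x_{s+1} + splitFormAt (s+2) m`.
[folklore] -/
theorem splitFormAt_add_two (s m : ℕ) (h : s + (m + 2) ≤ N + 1) :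
    splitFormAt k s (m + 2) h = MvPolynomial.X ⟨s, by omega⟩ * MvPolynomial.X ⟨s + 1, by omega⟩ +
      splitFormAt k (s + 2) m (by omega) := by
  classical
  have key : ∀ i : Fin (N + 1),
      (if s ≤ (i : ℕ) ∧ (i : ℕ) < s + (m + 2) ∧ ((i : ℕ) - s) % 2 = 0 then
        (if h' : (i : ℕ) + 1 < s + (m + 2) then
          MvPolynomial.X i * MvPolynomial.X (⟨(i : ℕ) + 1, by omega⟩ : Fin (N + 1))
          else MvPolynomial.X i * MvPolynomial.X i) else (0 : MvPolynomial (Fin (N + 1)) k)) =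
      (if i = ⟨s, by omega⟩ then
          MvPolynomial.X (⟨s, by omega⟩ : Fin (N + 1)) * MvPolynomial.X ⟨s + 1, by omega⟩ else 0) +
        (if s + 2 ≤ (i : ℕ) ∧ (i : ℕ) < s + 2 + m ∧ ((i : ℕ) - (s + 2)) % 2 = 0 then
          (if h' : (i : ℕ) + 1 < s + 2 + m then
            MvPolynomial.X i * MvPolynomial.X (⟨(i : ℕ) + 1, by omega⟩ : Fin (N + 1))
            else MvPolynomial.X i * MvPolynomial.X i) else 0) := by
    intro i
    by_cases his : i = ⟨s, by omega⟩
    · subst his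
      rw [if_pos (by simp), dif_pos (by simp), if_pos rfl]
      simp
    · have his' : (i : ℕ) ≠ s := fun h ↦ his (Fin.ext h)
      rw [if_neg his, zero_add]
      by_cases hc : s + 2 ≤ (i : ℕ) ∧ (i : ℕ) < s + 2 + m ∧ ((i : ℕ) - (s + 2)) % 2 = 0
      · rw [if_pos hc, if_pos ⟨by omega, by omega, by omega⟩]
        by_cases h1 : (i : ℕ) + 1 < s + (m + 2)
        · rw [dif_pos h1, dif_pos (by omega)]
        · rw [dif_neg h1, dif_neg (by omega)]
      · rw [if_neg hc, if_neg]
        omega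
  unfold splitFormAt
  simp_rw [key]
  rw [Finset.sum_add_distrib, Finset.sum_ite_eq']
  simp

/-- The block split form is a quadratic form. [folklore] -/
theorem isHomogeneous_splitFormAt (s m : ℕ) (h : s + m ≤ N + 1) : (splitFormAt k s m h).IsHomogeneous 2 := by
  unfold splitFormAt
  refine MvPolynomial.IsHomogeneous.sum _ _ _ fun i _ ↦ ?_
  split_ifs
  · exact (MvPolynomial.isHomogeneous_X k _).mul (MvPolynomial.isHomogeneous_X k _)
  · exact (MvPolynomial.isHomogeneous_X k _).mul (MvPolynomial.isHomogeneous_X k _)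
  · exact MvPolynomial.isHomogeneous_zero _ _ _

/-- Evaluation of the block split form. [folklore] -/
theorem eval_splitFormAt (s m : ℕ) (h : s + m ≤ N + 1) (u : Fin (N + 1) → k) :
    MvPolynomial.eval u (splitFormAt k s m h) = ∑ i : Fin (N + 1),
      if s ≤ (i : ℕ) ∧ (i : ℕ) < s + m ∧ ((i : ℕ) - s) % 2 = 0 then
        (if h' : (i : ℕ) + 1 < s + m then u i * u ⟨(i : ℕ) + 1, by omega⟩ else u i * u i) else 0 := by
  simp only [splitFormAt, map_sum]
  refine Finset.sum_congr rfl fun i _ ↦ ?_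
  split_ifs <;> simp

/-- The block split form takes the value `1` at the point `e_s + e_{s+1}` (for `m ≥ 1`), in
particular it is nonzero. [folklore] -/
theorem eval_splitFormAt_indicator (s m : ℕ) (h : s + m ≤ N + 1) (hm : 1 ≤ m) :
    MvPolynomial.eval (fun j : Fin (N + 1) ↦ if (j : ℕ) = s ∨ (j : ℕ) = s + 1 then (1 : k) else 0)
      (splitFormAt k s m h) = 1 := by
  rw [eval_splitFormAt, Finset.sum_eq_single ⟨s, by omega⟩]
  · rw [if_pos (by simp; omega)]
    by_cases h1 : ((⟨s, by omega⟩ : Fin (N + 1)) : ℕ) + 1 < s + m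
    · rw [dif_pos h1, if_pos (by simp), if_pos (by simp), mul_one]
    · rw [dif_neg h1, if_pos (by simp), mul_one]
  · intro i _ hi
    have his : (i : ℕ) ≠ s := fun h ↦ hi (Fin.ext h)
    by_cases hc : s ≤ (i : ℕ) ∧ (i : ℕ) < s + m ∧ ((i : ℕ) - s) % 2 = 0
    · have hu : (if (i : ℕ) = s ∨ (i : ℕ) = s + 1 then (1 : k) else 0) = 0 := by
        rw [if_neg]; omega
      rw [if_pos hc]
      simp only [hu, zero_mul, dite_eq_ite, ite_self]
    · rw [if_neg hc]
  · intro h; exact absurd (Finset.mem_univ _) h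

/-- `splitFormAt s m ≠ 0` for `m ≥ 1`. [folklore] -/
theorem splitFormAt_ne_zero (s m : ℕ) (h : s + m ≤ N + 1) (hm : 1 ≤ m) : splitFormAt k s m h ≠ 0 := by
  intro h0
  have h1 := eval_splitFormAt_indicator (k := k) s m h hm
  rw [h0, map_zero] at h1
  exact zero_ne_one h1

/-- The split form of `Motives/SplitQuadricNormalForm` is the block form on all variables. [folklore] -/
theorem splitForm_eq_splitFormAt : splitForm k N = splitFormAt k (N := N) 0 (N + 1) (by omega) := by
  unfold splitForm splitFormAt
  refine Finset.sum_congr rfl fun i _ ↦ ?_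
  have hi : (0 ≤ (i : ℕ) ∧ (i : ℕ) < 0 + (N + 1) ∧ ((i : ℕ) - 0) % 2 = 0) ↔ (i : ℕ) % 2 = 0 := by
    constructor
    · rintro ⟨-, -, h⟩; simpa using h
    · intro h; exact ⟨Nat.zero_le _, by omega, by simpa using h⟩
  by_cases h : (i : ℕ) % 2 = 0
  · rw [if_pos h, if_pos (hi.mpr h)]
    by_cases h' : (i : ℕ) + 1 < N + 1
    · rw [dif_pos h', dif_pos (by omega)]
    · rw [dif_neg h', dif_neg (by omega)]
  · rw [if_neg h, if_neg (fun hc ↦ h (hi.mp hc))]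

variable (k) in
/-- **Killing a set of variables**: `xⱼ ↦ 0` for `j ∈ S`, `xⱼ ↦ xⱼ` otherwise. [folklore] -/
def killSet (S : Set (Fin (N + 1))) [DecidablePred (· ∈ S)] :
    MvPolynomial (Fin (N + 1)) k →ₐ[k] MvPolynomial (Fin (N + 1)) k :=
  MvPolynomial.aeval fun j ↦ if j ∈ S then (0 : MvPolynomial (Fin (N + 1)) k) else MvPolynomial.X j

/-- Auxiliary computation (`killSet_X_of_mem`). [folklore] -/
theorem killSet_X_of_mem {S : Set (Fin (N + 1))} [DecidablePred (· ∈ S)] {j : Fin (N + 1)}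
    (hj : j ∈ S) : killSet k S (MvPolynomial.X j) = 0 := by
  simp [killSet, hj]

/-- Auxiliary computation (`killSet_X_of_notMem`). [folklore] -/
theorem killSet_X_of_notMem {S : Set (Fin (N + 1))} [DecidablePred (· ∈ S)] {j : Fin (N + 1)}
    (hj : j ∉ S) : killSet k S (MvPolynomial.X j) = MvPolynomial.X j := by
  simp [killSet, hj]

/-- `ker (killSet S) = (xⱼ : j ∈ S)` (`Literature.RingTheory.MvPolynomial.ker_aeval_ite_eq_span`).
[folklore] -/
theorem ker_killSet (S : Set (Fin (N + 1))) [DecidablePred (· ∈ S)] :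
    RingHom.ker (killSet k S) = Ideal.span ((fun j ↦ MvPolynomial.X j) '' S) :=
  Literature.RingTheory.MvPolynomial.ker_aeval_ite_eq_span S

/-- `killSet` is idempotent: `killSet S (killSet S p) = killSet S p`. [folklore] -/
theorem killSet_killSet (S : Set (Fin (N + 1))) [DecidablePred (· ∈ S)] (p : MvPolynomial (Fin (N + 1)) k) :
    killSet k S (killSet k S p) = killSet k S p := by
  have h : (killSet k S).comp (killSet k S) = killSet k S := by
    refine MvPolynomial.algHom_ext fun j ↦ ?_
    by_cases hj : j ∈ S
    · simp [killSet_X_of_mem hj]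
    · simp [killSet_X_of_notMem hj]
  exact congr($h p)

/-- `p - killSet S p ∈ (xⱼ : j ∈ S)`. [folklore] -/
theorem sub_killSet_mem (S : Set (Fin (N + 1))) [DecidablePred (· ∈ S)] (p : MvPolynomial (Fin (N + 1)) k) :
    p - killSet k S p ∈ Ideal.span ((fun j ↦ MvPolynomial.X j) '' S) := by
  rw [← ker_killSet, RingHom.mem_ker, map_sub, killSet_killSet, sub_self]

/-- **Killing variables outside the block does not change the block form.** [folklore] -/
theorem killSet_splitFormAt (s m : ℕ) (h : s + m ≤ N + 1) (S : Set (Fin (N + 1)))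
    [DecidablePred (· ∈ S)] (hS : ∀ j ∈ S, (j : ℕ) < s ∨ s + m ≤ (j : ℕ)) :
    killSet k S (splitFormAt k s m h) = splitFormAt k s m h := by
  have hX : ∀ j : Fin (N + 1), s ≤ (j : ℕ) → (j : ℕ) < s + m →
      killSet k S (MvPolynomial.X j) = MvPolynomial.X j := fun j hj1 hj2 ↦ by
    refine killSet_X_of_notMem fun hj ↦ ?_
    rcases hS j hj with h | h <;> omega
  unfold splitFormAt
  rw [map_sum]
  refine Finset.sum_congr rfl fun i _ ↦ ?_
  split_ifs with h1 h2
  · rw [map_mul, hX i h1.1 h1.2.1, hX _ (by simp; omega) (by simpa using h2)]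
  · rw [map_mul, hX i h1.1 h1.2.1]
  · rw [map_zero]

end SplitFormAt

end ProjectiveSpaceCells

end Literature.AlgebraicGeometry.Motives
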